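import Mathlib.LinearAlgebra.Matrix.SpecialLinearGroup
import Mathlib.NumberTheory.Padics.RingHoms
import Mathlib.Topology.Algebra.Group.Matrix
import Mathlib.Analysis.SpecificLimits.Basic
import Mathlib.Tactic.NoncommRing
import Literature.GroupTheory.SpecificGroups.SerreLiftingCongruences
import HarnessLib

/-!
# Serre's lemma: a closed subgroup of `SL₂(ℤ_l)` mapping onto `SL₂(𝔽_l)` is everything (`l ≥ 5`);
# [GenEll] Lemma 3.1 (iv)

* J.-P. Serre, *Abelian `l`-adic representations and elliptic curves* (1968), Ch. IV §3.4, Lemma 3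
  [cite: SerreAbelianLadic1968, IV §3.4 Lemma 3]: for a prime `l ≥ 5`, a closed subgroup `X ≤ SL₂(ℤ_l)`
  whose image in `SL₂(𝔽_l)` is all of `SL₂(𝔽_l)` equals `SL₂(ℤ_l)`
  (`SL2_eq_top_of_isClosed_of_map_toZMod_eq_top`).  Proof as in Serre: by induction on `n` the image
  of `X` in `SL₂(ℤ/lⁿ)` is everything — the kernel of `SL₂(ℤ/lⁿ⁺¹) → SL₂(ℤ/lⁿ)` is reached by `l`-th
  powers of lifts of `1 + cY`, `Y ∈ {E₁₂, E₂₁, (1 1; -1 -1)}` (`Y² = 0`; the congruences are in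
  `SerreLiftingCongruences.lean`, where `l ≥ 5` is used), whose sum spans the trace-zero matrices —
  and a closed subgroup dense in `SL₂(ℤ_l)` is `SL₂(ℤ_l)`.
* S. Mochizuki, *Arithmetic elliptic curves in general position*, Math. J. Okayama Univ. 52 (2010),
  Lemma 3.1 (iv) p. 14 [cite: MochizukiGenEll2010, Lem 3.1 (iv) p.14]: "Let `J ⊆ GL₂(ℤ_l)` be a closed
  subgroup whose image `H_J` in `GL₂(𝔽_l)` contains the matrix `α = (1 1; 0 1)`, as well as a matrix
  which is not upper triangular. Then `SL₂(ℤ_l) ⊆ J`."  We prove the form "image of `J` contains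
  `SL₂(𝔽_l)` ⇒ `SL₂(ℤ_l) ≤ J`" (`range_toGL_le_of_isClosed_of_range_le_map`): the commutators of `J` lie
  in the closed subgroup `SL₂(ℤ_l) ∩ J`, whose image contains the commutator subgroup of `SL₂(𝔽_l)`,
  which is everything for `l ≥ 5` (Lemma 3.1 (ii); Mathlib `Matrix.SL2.commutator_eq_top` with
  `λ = 2`, `λ² ≠ 1`), so Serre's lemma applies.  The hypothesis "`H_J ∋ α` and a non-upper-triangular
  matrix ⇒ `SL₂(𝔽_l) ≤ H_J`" is Lemma 3.1 (iii) (`GL2SubgroupContainsSL2.lean`); the two are combined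
  in the companion of the cell's statement file.

Conventions: `ℤ_l = ℤ_[l]` (Mathlib `PadicInt`), `SL₂ = Matrix.SpecialLinearGroup (Fin 2)` with
Mathlib's topology (induced from `M₂(ℤ_l)`), `GL₂ = GL (Fin 2)` with Mathlib's units topology,
reduction mod `l` = `PadicInt.toZMod`.  Everything is proved; no named facts, no definitions.
-/

namespace Literature.GroupTheory.SpecificGroups

open Matrix MatrixGroups Finset SerreLifting
open scoped commutatorElement

section Serre

variable {l : ℕ} [Fact l.Prime]

local notation "𝕄" => Matrix (Fin 2) (Fin 2) ℤ_[l]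

/-- `(↑l ^ n * C) i j = ↑l ^ n * C i j` in `M₂(ℤ_l)`. [folklore] -/
private theorem natCast_pow_mul_apply (n : ℕ) (C : 𝕄) (i j : Fin 2) :
    ((l : 𝕄) ^ n * C) i j = (l : ℤ_[l]) ^ n * C i j := by
  rw [← Nat.cast_pow, ← Matrix.diagonal_natCast, Matrix.diagonal_mul, Nat.cast_pow]

/-- `a • C = ↑a-scalar * C`: for `a = ↑l ^ n`. [folklore] -/
private theorem natCast_pow_smul_eq_mul (n : ℕ) (C : 𝕄) :
    ((l : ℤ_[l]) ^ n) • C = (l : 𝕄) ^ n * C := by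
  rw [Matrix.smul_eq_diagonal_mul, ← Nat.cast_pow, Matrix.diagonal_natCast, Nat.cast_pow]

/-- `↑l • C = ↑l-scalar * C`. [folklore] -/
private theorem natCast_smul_eq_mul (C : 𝕄) : (l : ℤ_[l]) • C = (l : 𝕄) * C := by
  rw [Matrix.smul_eq_diagonal_mul, Matrix.diagonal_natCast]

/-- Equality of reductions mod `l` in `SL₂(𝔽_l)` gives `x = s + l·C`. [folklore] -/
private theorem exists_eq_add_natCast_mul_of_map_eq {x s : SL(2, ℤ_[l])}
    (h : SpecialLinearGroup.map (PadicInt.toZMod (p := l)) x =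
      SpecialLinearGroup.map (PadicInt.toZMod (p := l)) s) :
    ∃ C : 𝕄, (x : 𝕄) = s + (l : 𝕄) * C := by
  have hent : ∀ i j, ∃ c : ℤ_[l], (x : 𝕄) i j - (s : 𝕄) i j = (l : ℤ_[l]) * c := by
    intro i j
    have hij := congrArg (fun g : SL(2, ZMod l) => (g : Matrix (Fin 2) (Fin 2) (ZMod l)) i j) h
    simp only [SpecialLinearGroup.map_apply_coe, RingHom.mapMatrix_apply, Matrix.map_apply] at hij
    have hmem : (x : 𝕄) i j - (s : 𝕄) i j ∈ RingHom.ker (PadicInt.toZMod (p := l)) := by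
      rw [RingHom.mem_ker, map_sub, hij, sub_self]
    rw [PadicInt.ker_toZMod, PadicInt.maximalIdeal_eq_span_p, Ideal.mem_span_singleton'] at hmem
    obtain ⟨c, hc⟩ := hmem
    exact ⟨c, by rw [← hc, mul_comm]⟩
  choose c hc using hent
  refine ⟨Matrix.of fun i j => c i j, ?_⟩
  ext i j
  rw [Matrix.add_apply, ← pow_one (l : 𝕄), natCast_pow_mul_apply, pow_one, Matrix.of_apply, ← hc i j]
  ring

/-- **Key lifting step** (Serre): if `X ≤ SL₂(ℤ_l)` reaches every residue class mod `l`, `Y² = 0` and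
`det(1 + cY) = 1`, then for every `n ≥ 1` some `y ∈ X` has `y = 1 + lⁿ·cY + lⁿ⁺¹·B`.
[cite: SerreAbelianLadic1968, IV §3.4 Lemma 3] -/
private theorem exists_mem_eq_one_add_smul (h5 : 5 ≤ l) (X : Subgroup SL(2, ℤ_[l]))
    (hX : ∀ s : SL(2, ℤ_[l]), ∃ x ∈ X, ∃ C : 𝕄, (x : 𝕄) = s + (l : 𝕄) * C)
    (Y : 𝕄) (hY : Y * Y = 0) (hdet : ∀ c : ℤ_[l], Matrix.det (1 + c • Y) = 1) (c : ℤ_[l])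
    {n : ℕ} (hn : 1 ≤ n) :
    ∃ y ∈ X, ∃ B : 𝕄, (y : 𝕄) = 1 + (l : 𝕄) ^ n * (c • Y) + (l : 𝕄) ^ (n + 1) * B := by
  induction n, hn using Nat.le_induction with
  | base =>
    obtain ⟨x, hxX, C, hxC⟩ := hX ⟨1 + c • Y, hdet c⟩
    have hZ : (c • Y) * (c • Y) = 0 := by
      rw [Matrix.smul_mul, Matrix.mul_smul, hY, smul_zero, smul_zero]
    obtain ⟨B', hB'⟩ :=
      exists_one_add_pow_eq_of_mul_self_eq_zero (Fact.out : l.Prime) h5 (c • Y) C hZ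
    refine ⟨x ^ l, X.pow_mem hxX l, B', ?_⟩
    rw [SpecialLinearGroup.coe_pow, hxC, SpecialLinearGroup.coe_mk, add_assoc, hB', pow_one]
  | succ n hn ih =>
    obtain ⟨y, hyX, B, hyB⟩ := ih
    obtain ⟨B', hB'⟩ := exists_one_add_pow_eq_of_le (Fact.out : l.Prime) (by omega) hn (c • Y) B
    refine ⟨y ^ l, X.pow_mem hyX l, B', ?_⟩
    rw [SpecialLinearGroup.coe_pow, hyB, add_assoc, hB']

/-- The three square-zero directions `E₀₁`, `E₁₀`, `W = (1 1; -1 -1)` of `M₂`. [folklore] -/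
private theorem sq_zero_directions :
    ((!![0, 1; 0, 0] : 𝕄) * !![0, 1; 0, 0] = 0 ∧ ∀ c : ℤ_[l], Matrix.det (1 + c • (!![0, 1; 0, 0] : 𝕄)) = 1) ∧
    ((!![0, 0; 1, 0] : 𝕄) * !![0, 0; 1, 0] = 0 ∧ ∀ c : ℤ_[l], Matrix.det (1 + c • (!![0, 0; 1, 0] : 𝕄)) = 1) ∧
    ((!![1, 1; -1, -1] : 𝕄) * !![1, 1; -1, -1] = 0 ∧
      ∀ c : ℤ_[l], Matrix.det (1 + c • (!![1, 1; -1, -1] : 𝕄)) = 1) := by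
  refine ⟨⟨?_, fun c => ?_⟩, ⟨?_, fun c => ?_⟩, ⟨?_, fun c => ?_⟩⟩
  all_goals first
    | (ext i j; fin_cases i <;> fin_cases j <;> simp [Matrix.mul_apply, Fin.sum_univ_two])
    | (rw [Matrix.det_fin_two]; simp; ring)
    | (rw [Matrix.det_fin_two]; simp)

/-- **Lifting a class `≡ 1 (mod lⁿ)` one level up**: for `u ∈ SL₂(ℤ_l)` with `u = 1 + lⁿ·C` (`n ≥ 1`)
there is `y ∈ X` with `y ≡ u (mod lⁿ⁺¹)`. [cite: SerreAbelianLadic1968, IV §3.4 Lemma 3] -/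
private theorem exists_mem_eq_add_of_eq_one_add (h5 : 5 ≤ l) (X : Subgroup SL(2, ℤ_[l]))
    (hX : ∀ s : SL(2, ℤ_[l]), ∃ x ∈ X, ∃ C : 𝕄, (x : 𝕄) = s + (l : 𝕄) * C) {n : ℕ} (hn : 1 ≤ n)
    (u : SL(2, ℤ_[l])) (C : 𝕄) (hu : (u : 𝕄) = 1 + (l : 𝕄) ^ n * C) :
    ∃ y ∈ X, ∃ D : 𝕄, (y : 𝕄) = u + (l : 𝕄) ^ (n + 1) * D := by
  have hl0 : (l : ℤ_[l]) ^ n ≠ 0 := pow_ne_zero _ (by exact_mod_cast (Fact.out : l.Prime).ne_zero)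
  -- the trace of `C` is divisible by `l`
  obtain ⟨e, he⟩ : ∃ e : ℤ_[l], C 0 0 + C 1 1 = (l : ℤ_[l]) * e := by
    have hdet := u.prop
    rw [hu, Matrix.det_fin_two] at hdet
    simp only [Matrix.add_apply, Matrix.one_apply_eq, natCast_pow_mul_apply, Fin.isValue, ne_eq,
      zero_ne_one, not_false_eq_true, Matrix.one_apply_ne, one_ne_zero, zero_add] at hdet
    obtain ⟨k, rfl⟩ : ∃ k, n = k + 1 := ⟨n - 1, by omega⟩
    refine ⟨-((l : ℤ_[l]) ^ k * (C 0 0 * C 1 1 - C 0 1 * C 1 0)), ?_⟩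
    apply mul_left_cancel₀ hl0
    linear_combination hdet
  obtain ⟨⟨hY₁, hd₁⟩, ⟨hY₂, hd₂⟩, ⟨hY₃, hd₃⟩⟩ := sq_zero_directions (l := l)
  obtain ⟨y₁, hy₁X, B₁, hy₁⟩ :=
    exists_mem_eq_one_add_smul h5 X hX _ hY₁ hd₁ (C 0 1 - C 0 0) hn
  obtain ⟨y₂, hy₂X, B₂, hy₂⟩ :=
    exists_mem_eq_one_add_smul h5 X hX _ hY₂ hd₂ (C 1 0 + C 0 0) hn
  obtain ⟨y₃, hy₃X, B₃, hy₃⟩ := exists_mem_eq_one_add_smul h5 X hX _ hY₃ hd₃ (C 0 0) hn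
  obtain ⟨D, hD⟩ := exists_mul_mul_eq_one_add (l := l) hn hy₁ hy₂ hy₃
  -- the decomposition of `C`
  have hC : C = (C 0 1 - C 0 0) • (!![0, 1; 0, 0] : 𝕄) + (C 1 0 + C 0 0) • (!![0, 0; 1, 0] : 𝕄) +
      C 0 0 • (!![1, 1; -1, -1] : 𝕄) + (C 0 0 + C 1 1) • (!![0, 0; 0, 1] : 𝕄) := by
    ext i j
    fin_cases i <;> fin_cases j <;> simp
  refine ⟨y₁ * y₂ * y₃, X.mul_mem (X.mul_mem hy₁X hy₂X) hy₃X, D - e • (!![0, 0; 0, 1] : 𝕄), ?_⟩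
  rw [SpecialLinearGroup.coe_mul, SpecialLinearGroup.coe_mul, hD, hu]
  conv_rhs => rw [hC]
  rw [he, mul_smul, natCast_smul_eq_mul, pow_succ]
  noncomm_ring

/-- **Approximation to every order**: if `X` reaches every class mod `l`, it reaches every class
mod `lⁿ`, `n ≥ 1`. [cite: SerreAbelianLadic1968, IV §3.4 Lemma 3] -/
private theorem exists_mem_eq_add (h5 : 5 ≤ l) (X : Subgroup SL(2, ℤ_[l]))
    (hX : ∀ s : SL(2, ℤ_[l]), ∃ x ∈ X, ∃ C : 𝕄, (x : 𝕄) = s + (l : 𝕄) * C) (n : ℕ) (hn : 1 ≤ n)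
    (s : SL(2, ℤ_[l])) : ∃ x ∈ X, ∃ C : 𝕄, (x : 𝕄) = s + (l : 𝕄) ^ n * C := by
  induction n, hn using Nat.le_induction with
  | base => simpa only [pow_one] using hX s
  | succ n hn ih =>
    obtain ⟨x, hxX, C, hxC⟩ := ih
    have hinv : ((x⁻¹ : SL(2, ℤ_[l])) : 𝕄) * (x : 𝕄) = 1 := by
      rw [← SpecialLinearGroup.coe_mul, inv_mul_cancel, SpecialLinearGroup.coe_one]
    have hinv' : (x : 𝕄) * ((x⁻¹ : SL(2, ℤ_[l])) : 𝕄) = 1 := by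
      rw [← SpecialLinearGroup.coe_mul, mul_inv_cancel, SpecialLinearGroup.coe_one]
    have hcomm : Commute (((x⁻¹ : SL(2, ℤ_[l])) : 𝕄)) ((l : 𝕄) ^ n) :=
      ((Nat.cast_commute l _).pow_left n).symm
    have hu : ((x⁻¹ * s : SL(2, ℤ_[l])) : 𝕄) =
        1 + (l : 𝕄) ^ n * (-(((x⁻¹ : SL(2, ℤ_[l])) : 𝕄) * C)) := by
      have hs : (s : 𝕄) = x - (l : 𝕄) ^ n * C := by rw [hxC]; abel
      rw [SpecialLinearGroup.coe_mul, hs, mul_sub, hinv, hcomm.left_comm C, mul_neg, sub_eq_add_neg]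
    obtain ⟨y, hyX, D, hyD⟩ := exists_mem_eq_add_of_eq_one_add h5 X hX hn (x⁻¹ * s) _ hu
    refine ⟨x * y, X.mul_mem hxX hyX, (x : 𝕄) * D, ?_⟩
    have hcomm' : Commute (x : 𝕄) ((l : 𝕄) ^ (n + 1)) := ((Nat.cast_commute l _).pow_left (n + 1)).symm
    rw [SpecialLinearGroup.coe_mul, hyD, mul_add, SpecialLinearGroup.coe_mul, ← mul_assoc, hinv', one_mul,
      hcomm'.left_comm D]

/-- **Serre's lemma** ([Serre, *Abelian `l`-adic representations and elliptic curves*] IV §3.4, Lemma 3,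
as used in the proof of [GenEll] Lemma 3.1 (iv)): for a prime `l ≥ 5`, a CLOSED subgroup `X` of
`SL₂(ℤ_l)` whose reduction modulo `l` is all of `SL₂(𝔽_l)` is `SL₂(ℤ_l)` itself.
[cite: SerreAbelianLadic1968, IV §3.4 Lemma 3] -/
theorem SL2_eq_top_of_isClosed_of_map_toZMod_eq_top (h5 : 5 ≤ l) (X : Subgroup SL(2, ℤ_[l]))
    (hXc : IsClosed (X : Set SL(2, ℤ_[l])))
    (hXs : X.map (SpecialLinearGroup.map (PadicInt.toZMod (p := l))) = ⊤) : X = ⊤ := by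
  have hX : ∀ s : SL(2, ℤ_[l]), ∃ x ∈ X, ∃ C : 𝕄, (x : 𝕄) = s + (l : 𝕄) * C := by
    intro s
    have hs : SpecialLinearGroup.map (PadicInt.toZMod (p := l)) s ∈
        X.map (SpecialLinearGroup.map (PadicInt.toZMod (p := l))) := by
      rw [hXs]; exact Subgroup.mem_top _
    obtain ⟨x, hxX, hx⟩ := Subgroup.mem_map.mp hs
    exact ⟨x, hxX, exists_eq_add_natCast_mul_of_map_eq hx⟩
  rw [eq_top_iff]
  intro s _
  choose x hxX C hxC using fun n : ℕ => exists_mem_eq_add h5 X hX (n + 1) (by omega) s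
  refine hXc.mem_of_tendsto (f := x) (b := Filter.atTop) ?_ (Filter.Eventually.of_forall hxX)
  have hind : Topology.IsInducing (fun A : SL(2, ℤ_[l]) => (A : 𝕄)) := ⟨rfl⟩
  rw [hind.tendsto_nhds_iff]
  change Filter.Tendsto (fun n => (x n : 𝕄)) Filter.atTop (nhds (s : 𝕄))
  refine tendsto_pi_nhds.mpr fun i => tendsto_pi_nhds.mpr fun j => ?_
  have hl1 : ((l : ℝ)⁻¹) < 1 := inv_lt_one_of_one_lt₀ (by exact_mod_cast (Fact.out : l.Prime).one_lt)
  have hl0 : 0 ≤ ((l : ℝ)⁻¹) := by positivity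
  have hb : ∀ n, ‖(x n : 𝕄) i j - (s : 𝕄) i j‖ ≤ ((l : ℝ)⁻¹) ^ (n + 1) := by
    intro n
    rw [hxC n, Matrix.add_apply, add_sub_cancel_left, natCast_pow_mul_apply, norm_mul,
      norm_pow, PadicInt.norm_p]
    exact mul_le_of_le_one_right (pow_nonneg hl0 _) (PadicInt.norm_le_one _)
  refine tendsto_iff_norm_sub_tendsto_zero.mpr (squeeze_zero (fun n => norm_nonneg _) hb ?_)
  exact (tendsto_pow_atTop_nhds_zero_of_lt_one hl0 hl1).comp (Filter.tendsto_add_atTop_nat 1)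

/-- `2 ≠ 0` and `2² ≠ 1` in `𝔽_l` for `l ≥ 5` (the element `λ` with `λ² ≠ 1` of the printed proof of
[GenEll] Lemma 3.1 (ii)). [cite: MochizukiGenEll2010, Lem 3.1 (ii) p.14] -/
theorem two_ne_zero_and_sq_ne_one (h5 : 5 ≤ l) : (2 : ZMod l) ≠ 0 ∧ (2 : ZMod l) ^ 2 ≠ 1 := by
  have h2 : ¬ l ∣ 2 := fun h => by have := Nat.le_of_dvd (by norm_num) h; omega
  have h3 : ¬ l ∣ 3 := fun h => by have := Nat.le_of_dvd (by norm_num) h; omega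
  constructor
  · intro h
    apply h2
    exact (ZMod.natCast_eq_zero_iff 2 l).mp (by exact_mod_cast h)
  · intro h
    apply h3
    have h' : ((3 : ℕ) : ZMod l) = 0 := by
      have : (2 : ZMod l) ^ 2 - 1 = 0 := sub_eq_zero.mpr h
      calc ((3 : ℕ) : ZMod l) = (2 : ZMod l) ^ 2 - 1 := by norm_num
        _ = 0 := this
    exact (ZMod.natCast_eq_zero_iff 3 l).mp h'

/-- Naturality of `toGL` with respect to reduction of coefficients. [folklore] -/
private theorem map_toGL_eq {R S : Type*} [CommRing R] [CommRing S] (f : R →+* S) (x : SL(2, R)) :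
    Matrix.GeneralLinearGroup.map f (Matrix.SpecialLinearGroup.toGL x) =
      Matrix.SpecialLinearGroup.toGL (SpecialLinearGroup.map f x) :=
  Units.ext rfl

/-- **[GenEll] Lemma 3.1 (iv), closed-subgroup form**: for a prime `l ≥ 5` and a closed subgroup
`J ≤ GL₂(ℤ_l)` whose image in `GL₂(𝔽_l)` contains `SL₂(𝔽_l)`, one has `SL₂(ℤ_l) ≤ J`.  (Proof as
printed: the commutators of `J` lie in `SL₂(ℤ_l) ∩ J`, a closed subgroup mapping onto the perfect group
`SL₂(𝔽_l)` = Lemma 3.1 (ii), hence equal to `SL₂(ℤ_l)` by Serre's lemma.)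
[cite: MochizukiGenEll2010, Lem 3.1 (iv) p.14] -/
theorem range_toGL_le_of_isClosed_of_range_le_map (h5 : 5 ≤ l) (J : Subgroup (GL (Fin 2) ℤ_[l]))
    (hJc : IsClosed (J : Set (GL (Fin 2) ℤ_[l])))
    (hJ : (Matrix.SpecialLinearGroup.toGL : SL(2, ZMod l) →* GL (Fin 2) (ZMod l)).range ≤
      J.map (Matrix.GeneralLinearGroup.map (PadicInt.toZMod (p := l)))) :
    (Matrix.SpecialLinearGroup.toGL : SL(2, ℤ_[l]) →* GL (Fin 2) ℤ_[l]).range ≤ J := by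
  set X : Subgroup SL(2, ℤ_[l]) := J.comap Matrix.SpecialLinearGroup.toGL with hXdef
  have hXc : IsClosed (X : Set SL(2, ℤ_[l])) := by
    rw [hXdef, Subgroup.coe_comap]
    exact hJc.preimage Matrix.SpecialLinearGroup.continuous_toGL
  have hXs : X.map (SpecialLinearGroup.map (PadicInt.toZMod (p := l))) = ⊤ := by
    obtain ⟨h2, h4⟩ := two_ne_zero_and_sq_ne_one h5
    rw [eq_top_iff, ← Matrix.SL2.commutator_eq_top h2 h4, commutator_def, Subgroup.commutator_le]
    rintro a' - b' -
    obtain ⟨a, haJ, ha⟩ := Subgroup.mem_map.mp (hJ ⟨a', rfl⟩)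
    obtain ⟨b, hbJ, hb⟩ := Subgroup.mem_map.mp (hJ ⟨b', rfl⟩)
    have hdet : Matrix.det ((⁅a, b⁆ : GL (Fin 2) ℤ_[l]) : 𝕄) = 1 := by
      have h1 : Matrix.GeneralLinearGroup.det (⁅a, b⁆ : GL (Fin 2) ℤ_[l]) = 1 := by
        rw [map_commutatorElement, commutatorElement_eq_one_iff_commute]
        exact Commute.all _ _
      have h2 := congrArg (fun u : ℤ_[l]ˣ => (u : ℤ_[l])) h1
      simp only [Matrix.GeneralLinearGroup.val_det_apply, Units.val_one] at h2
      exact h2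
    set xg : SL(2, ℤ_[l]) := ⟨((⁅a, b⁆ : GL (Fin 2) ℤ_[l]) : 𝕄), hdet⟩ with hxg_def
    have hxg : Matrix.SpecialLinearGroup.toGL xg = ⁅a, b⁆ := Units.ext rfl
    have hxX : xg ∈ X := by
      rw [hXdef, Subgroup.mem_comap, hxg, commutatorElement_def]
      exact J.mul_mem (J.mul_mem (J.mul_mem haJ hbJ) (J.inv_mem haJ)) (J.inv_mem hbJ)
    refine ⟨xg, hxX, ?_⟩
    apply Matrix.SpecialLinearGroup.toGL_injective
    rw [map_commutatorElement, ← ha, ← hb, ← map_commutatorElement, ← hxg, map_toGL_eq]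
  intro g hg
  obtain ⟨s, rfl⟩ := hg
  have hs : s ∈ X := by
    rw [SL2_eq_top_of_isClosed_of_map_toZMod_eq_top h5 X hXc hXs]; exact Subgroup.mem_top _
  exact hs

end Serre

end Literature.GroupTheory.SpecificGroups
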